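import Summits.ResolutionOfSingularities.ResolutionOfSingularities.Theorems.PerturbationDominance
import HarnessLib

/-!
# PerturbationDensity — decomp-res node «PerturbationLadder» (lens-1), generation 20, PART VIII (§30), second half:
RANK-ONE ITERATION and LEMMA B HYPOTHESIS-FREE (`isDenseOver_of_firstOrderApprox`, `isDenseOver_of_monomialChange`,
`monomialValues_injective_of_isValIndepOver`; file 2 of 2, imports `PerturbationDominance`)

WRITER PROVENANCE (decomp-res-writer-1 g8): lines 327–532 of `HOME/decomp-res-lens-1/g20/tree/PerturbationDensity.lean`
(sha256 6d5a6373…) VERBATIM, landed under CRITIC-LEDGER row 153 (CLEARED, lens-1 g20 MAP +2); writer changes = split and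
linter option dropped only.  Supports stmt-ResolutionOfSingularities-0641 (helper).

ORIGINAL COMPANION HEADER.
# PerturbationDensity — TREE-FACING COMPANION of the gen-20 node `PerturbationLadder`, PART VIII (§30)

Lemma B of the gen-17 inhabitant certificates, hypothesis-free, in kernel: first-order perturbation of a monomial
chart preserves density (`isDenseOver_of_firstOrderApprox`, `isDenseOver_of_monomialChange`).  This file is the
node's `section Perturbation` VERBATIM, re-pointed at the landed tree declarations `ToricLadder.IsDenseOver`,
`ToricLadder.IsValIndepOver` (by `open`) and `DefectlessLadder.valuation_le_pow_of_rankOne`; pure additions, no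
tree statement touched.  Suggested landing: `Theorems/PerturbationDensity.lean` (writer-1), namespace below.
-/

open scoped BigOperators

namespace Summit.ResolutionOfSingularities.ResolutionOfSingularities.Theorems.PerturbationDensity

open Summit.ResolutionOfSingularities.ResolutionOfSingularities.Theorems.ToricLadder
open Summit.ResolutionOfSingularities.ResolutionOfSingularities.Theorems.DefectlessLadder

/-! ## §30 (continued) — (c) ITERATION, (d) RANK ONE, and the two headline theorems

Setting, statement and the proof sketch (a)–(d) are in the module `PerturbationDominance` (PART VIII docstring);
this file continues `section Perturbation` with the same variables. -/

section Perturbation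

variable {k K : Type} [Field k] [Field K] [Algebra k K]

/-- **RANK ONE IS ARCHIMEDEAN (multiplicative form on values).** [folklore] -/
theorem exists_pow_mul_lt_of_rankOne (O : ValuationSubring K) (hRO : Nonempty O.valuation.RankOne)
    {δ : O.ValueGroup} (hδ : δ < 1) (c : O.ValueGroup) {γ : O.ValueGroup} (hγ : γ ≠ 0) :
    ∃ m : ℕ, δ ^ m * c < γ := by
  obtain ⟨hRO⟩ := hRO
  by_cases hδ0 : δ = 0
  · exact ⟨1, by rw [hδ0, pow_one, zero_mul]; exact zero_lt_iff.mpr hγ⟩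
  by_cases hc0 : c = 0
  · exact ⟨0, by rw [hc0, mul_zero]; exact zero_lt_iff.mpr hγ⟩
  obtain ⟨ε, hε⟩ := O.valuation_surjective δ
  obtain ⟨x, hx⟩ := O.valuation_surjective c
  obtain ⟨w, hwγ⟩ := O.valuation_surjective γ
  have hε0 : ε ≠ 0 := by rw [← (O.valuation).ne_zero_iff, hε]; exact hδ0
  have hinv : 1 < O.valuation ε⁻¹ := by
    rw [map_inv₀, hε]
    exact one_lt_inv_iff₀.mpr ⟨zero_lt_iff.mpr hδ0, hδ⟩
  obtain ⟨n, hn⟩ := valuation_le_pow_of_rankOne O hRO (x / w) hinv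
  rw [map_div₀, map_inv₀, hε, hx, hwγ, inv_pow, div_le_iff₀ (zero_lt_iff.mpr hγ)] at hn
  -- hn : c ≤ (δ ^ n)⁻¹ * γ
  refine ⟨n + 1, ?_⟩
  have hpow : δ ^ n ≠ 0 := pow_ne_zero _ hδ0
  have h1 : δ ^ n * c ≤ γ := by
    calc δ ^ n * c ≤ δ ^ n * ((δ ^ n)⁻¹ * γ) := mul_le_mul_right hn _
      _ = γ := by rw [← mul_assoc, mul_inv_cancel₀ hpow, one_mul]
  calc δ ^ (n + 1) * c = δ * (δ ^ n * c) := by rw [pow_succ, mul_comm (δ ^ n) δ, mul_assoc]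
    _ ≤ δ * γ := mul_le_mul_right h1 _
    _ < 1 * γ := mul_lt_mul_of_pos_right hδ (zero_lt_iff.mpr hγ)
    _ = γ := one_mul _

/-- **THE ITERATION.** Density over `F₀` plus a first-order transfer `F₀ → L` (factor `δ ≤ 1`)
approximates every `x ∈ K` from `L` either to within the target `v w` or to within `δ^m · v x`.
[folklore] -/
theorem exists_approx_iterate (O : ValuationSubring K) (F₀ L : IntermediateField k K)
    {δ : O.ValueGroup} (hδ : δ ≤ 1)
    (htrans : ∀ b ∈ F₀, ∃ b' ∈ L, O.valuation (b - b') ≤ δ * O.valuation b)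
    (hd : IsDenseOver O F₀) {w : K} (hw : w ≠ 0) :
    ∀ (m : ℕ) (x : K), ∃ a ∈ L,
      O.valuation (x - a) < O.valuation w ∨ O.valuation (x - a) ≤ δ ^ m * O.valuation x := by
  intro m
  induction m with
  | zero => intro x; exact ⟨0, L.zero_mem, Or.inr (by simp)⟩
  | succ m ih =>
    intro x
    obtain ⟨b, hbF, hxb⟩ := hd x w hw
    by_cases hlt : O.valuation (x - b) < O.valuation x
    · have hvb : O.valuation b = O.valuation x := by
        apply Valuation.map_eq_of_sub_lt; rw [Valuation.map_sub_swap]; exact hlt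
      obtain ⟨b', hb'L, hbb'⟩ := htrans b hbF
      obtain ⟨a₁, ha₁L, h₁⟩ := ih (x - b')
      refine ⟨b' + a₁, L.add_mem hb'L ha₁L, ?_⟩
      have hxa : x - (b' + a₁) = (x - b') - a₁ := by ring
      rw [hxa]
      have hx₁ : O.valuation (x - b') ≤ max (O.valuation (x - b)) (δ * O.valuation x) := by
        have : x - b' = (x - b) + (b - b') := by ring
        rw [this]
        exact (Valuation.map_add _ _ _).trans (max_le_max le_rfl (hvb ▸ hbb'))
      rcases h₁ with h₁ | h₁
      · exact Or.inl h₁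
      · rcases le_total (O.valuation (x - b)) (δ * O.valuation x) with h2 | h2
        · right
          calc O.valuation (x - b' - a₁) ≤ δ ^ m * O.valuation (x - b') := h₁
            _ ≤ δ ^ m * (δ * O.valuation x) := mul_le_mul_right (hx₁.trans (max_le h2 le_rfl)) _
            _ = δ ^ (m + 1) * O.valuation x := by rw [pow_succ, mul_assoc]
        · left
          calc O.valuation (x - b' - a₁) ≤ δ ^ m * O.valuation (x - b') := h₁
            _ ≤ δ ^ m * O.valuation (x - b) := mul_le_mul_right (hx₁.trans (max_le le_rfl h2)) _
            _ ≤ 1 * O.valuation (x - b) := mul_le_mul_left (pow_le_one₀ zero_le hδ) _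
            _ = O.valuation (x - b) := one_mul _
            _ < O.valuation w := hxb
    · refine ⟨0, L.zero_mem, Or.inl ?_⟩
      rw [sub_zero]
      exact (not_lt.mp hlt).trans_lt hxb

/-- **DENSITY TRANSFER (abstract form).** In rank one, density over `F₀` and a first-order transfer
`F₀ → L` with a factor `δ < 1` give density over `L`. [folklore] -/
theorem isDenseOver_of_transfer (O : ValuationSubring K) (hRO : Nonempty O.valuation.RankOne)
    (F₀ L : IntermediateField k K) {δ : O.ValueGroup} (hδ : δ < 1)
    (htrans : ∀ b ∈ F₀, ∃ b' ∈ L, O.valuation (b - b') ≤ δ * O.valuation b)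
    (hd : IsDenseOver O F₀) : IsDenseOver O L := by
  intro x w hw
  have hγ : O.valuation w ≠ 0 := (Valuation.ne_zero_iff _).mpr hw
  obtain ⟨m, hm⟩ := exists_pow_mul_lt_of_rankOne O hRO hδ (O.valuation x) hγ
  obtain ⟨a, haL, h⟩ := exists_approx_iterate O F₀ L hδ.le htrans hd hw m x
  exact ⟨a, haL, h.elim id fun h => h.trans_lt hm⟩

/-- **LEMMA B, FIRST-ORDER FORM (hypothesis-free kernel theorem).**  Let `(K, O)` be of rank one
with `k ⊆ O`, `y : Fin n → K` a tuple with INJECTIVE MONOMIAL VALUES, and suppose `K` is dense over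
`k(y)`.  If an intermediate field `L` knows every `y i` TO FIRST ORDER — some `w i ∈ L` has
`v(y i - w i) < v(y i)` — then `K` is dense over `L`.  (Paper Lemma B's isometry `σ : y ↦ u` and
Neumann series in the completion `𝔸_y` are replaced by the transfer `exists_firstOrder_transfer` and
the archimedean iteration `exists_approx_iterate`; no completion, no separability, any characteristic.)
[folklore] -/
theorem isDenseOver_of_firstOrderApprox (O : ValuationSubring K) (hRO : Nonempty O.valuation.RankOne)
    (hk : ∀ c : k, algebraMap k K c ∈ O) {n : ℕ} {y w : Fin n → K}
    (hM : Function.Injective fun a : Fin n →₀ ℕ => a.prod fun i e => O.valuation (y i) ^ e)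
    (L : IntermediateField k K) (hwL : ∀ i, w i ∈ L)
    (hw : ∀ i, O.valuation (y i - w i) < O.valuation (y i))
    (hd : IsDenseOver O (IntermediateField.adjoin k (Set.range y))) : IsDenseOver O L := by
  classical
  -- the uniform first-order factor `δ < 1`
  have hy0 : ∀ i, O.valuation (y i) ≠ 0 := fun i h => by
    have := hw i; rw [h] at this; exact (not_lt_of_ge zero_le) this
  set r : Fin n → O.ValueGroup := fun i => O.valuation (y i - w i) * (O.valuation (y i))⁻¹ with hr
  have hri : ∀ i, O.valuation (y i - w i) = r i * O.valuation (y i) := fun i => by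
    rw [hr]; dsimp only; rw [inv_mul_cancel_right₀ (hy0 i)]
  have hr1 : ∀ i, r i < 1 := fun i => by
    by_contra h
    have h' : O.valuation (y i) ≤ O.valuation (y i - w i) := by
      rw [hri i]
      calc O.valuation (y i) = 1 * O.valuation (y i) := (one_mul _).symm
        _ ≤ r i * O.valuation (y i) := mul_le_mul_left (not_lt.mp h) _
    exact absurd (hw i) (not_lt.mpr h')
  obtain ⟨δ, hδ1, hδ⟩ : ∃ δ : O.ValueGroup, δ < 1 ∧ ∀ i, O.valuation (y i - w i) ≤ δ * O.valuation (y i) := by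
    rcases (Finset.univ : Finset (Fin n)).eq_empty_or_nonempty with h0 | hne
    · refine ⟨0, zero_lt_one, fun i => ?_⟩
      exact absurd (Finset.mem_univ i) (by rw [h0]; exact Finset.notMem_empty i)
    · obtain ⟨i₀, -, hmax⟩ := Finset.exists_max_image Finset.univ r hne
      exact ⟨r i₀, hr1 i₀, fun i => by
        rw [hri i]; exact mul_le_mul_left (hmax i (Finset.mem_univ i)) _⟩
  exact isDenseOver_of_transfer O hRO (IntermediateField.adjoin k (Set.range y)) L hδ1
    (fun b hb => exists_firstOrder_transfer O hk hM hδ1 hδ L hwL hb) hd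

/-- **LEMMA B AS USED BY THE INHABITANT CERTIFICATES (monomial change of chart).**  Rank one,
`k ⊆ O` with `k`-RATIONAL RESIDUES on `O`, `y` a tuple with injective monomial values over which `K` is
dense.  Then `K` is dense over `k(u)` for ANY tuple `u` of non-zero elements in whose Laurent
monomials every `y i` finds its value (`v(y i) = v(uᴬ⁽ⁱ⁾)`) — e.g. any `u` whose values form another
basis of the value lattice spanned by the `v(y i)`.  (The first-order approximants are
`w i := cᵢ · uᴬ⁽ⁱ⁾` with `cᵢ ∈ k` the residue of `y i / uᴬ⁽ⁱ⁾`.) [folklore] -/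
theorem isDenseOver_of_monomialChange (O : ValuationSubring K) (hRO : Nonempty O.valuation.RankOne)
    (hk : ∀ c : k, algebraMap k K c ∈ O)
    (hres : ∀ z ∈ O, ∃ c : k, O.valuation (z - algebraMap k K c) < 1)
    {n m : ℕ} {y : Fin n → K} {u : Fin m → K}
    (hM : Function.Injective fun a : Fin n →₀ ℕ => a.prod fun i e => O.valuation (y i) ^ e)
    (hu : ∀ j, u j ≠ 0)
    (hval : ∀ i, ∃ A : Fin m → ℤ, O.valuation (y i) = ∏ j, O.valuation (u j) ^ A j)
    (hd : IsDenseOver O (IntermediateField.adjoin k (Set.range y))) :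
    IsDenseOver O (IntermediateField.adjoin k (Set.range u)) := by
  classical
  set L := IntermediateField.adjoin k (Set.range u)
  have huL : ∀ j, u j ∈ L := fun j => IntermediateField.subset_adjoin k _ ⟨j, rfl⟩
  have hy0 : ∀ i, y i ≠ 0 := ne_zero_of_monomialValues_injective O hM
  -- first-order approximants `w i = c i * ∏ u j ^ A j`
  have hw : ∀ i, ∃ wi ∈ L, O.valuation (y i - wi) < O.valuation (y i) := by
    intro i
    obtain ⟨A, hA⟩ := hval i
    set M : K := ∏ j, u j ^ A j with hMdef
    have hM0 : M ≠ 0 := Finset.prod_ne_zero_iff.mpr fun j _ => zpow_ne_zero _ (hu j)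
    have hvM : O.valuation M = O.valuation (y i) := by
      rw [hA, hMdef, map_prod]; simp only [map_zpow₀]
    have hML : M ∈ L := L.toSubfield.prod_mem fun j _ => ?_
    swap
    · exact zpow_mem (huL j) _
    -- the residue constant of `y i / M`
    have hzO : y i / M ∈ O := by
      rw [← O.valuation_le_one_iff, map_div₀, hvM, div_self ((Valuation.ne_zero_iff _).mpr (hy0 i))]
    obtain ⟨c, hc⟩ := hres _ hzO
    refine ⟨algebraMap k K c * M, L.mul_mem (L.algebraMap_mem c) hML, ?_⟩
    have hsplit : y i - algebraMap k K c * M = (y i / M - algebraMap k K c) * M := by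
      field_simp
    rw [hsplit, map_mul, hvM]
    calc O.valuation (y i / M - algebraMap k K c) * O.valuation (y i) < 1 * O.valuation (y i) :=
          mul_lt_mul_of_pos_right hc (zero_lt_iff.mpr ((Valuation.ne_zero_iff _).mpr (hy0 i)))
      _ = O.valuation (y i) := one_mul _
  choose w hwL hwlt using hw
  exact isDenseOver_of_firstOrderApprox O hRO hk hM L hwL hwlt hd

/-- **LINK TO THE TORIC DATUM.** A tuple whose values are `ℤ`-independent modulo the value group of
some intermediate field (`IsValIndepOver`, the datum of `ToricDenseBelow`) has injective monomial
values. [folklore] -/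
theorem monomialValues_injective_of_isValIndepOver (O : ValuationSubring K)
    (F₁ : IntermediateField k K) {n : ℕ} {y : Fin n → K} (hy : IsValIndepOver O F₁ y) :
    Function.Injective fun a : Fin n →₀ ℕ => a.prod fun i e => O.valuation (y i) ^ e := by
  classical
  intro a b hab
  dsimp only at hab
  have hy0 : ∀ i, O.valuation (y i) ≠ 0 := fun i => (Valuation.ne_zero_iff _).mpr (hy.1 i)
  -- pass to total products with `ℤ` exponents
  have hprodZ : ∀ c : Fin n →₀ ℕ, (c.prod fun i e => O.valuation (y i) ^ e) =
      ∏ i, O.valuation (y i) ^ ((c i : ℕ) : ℤ) := by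
    intro c
    rw [Finsupp.prod_fintype _ _ (fun i => by simp)]
    simp only [zpow_natCast]
  rw [hprodZ a, hprodZ b] at hab
  set mZ : Fin n → ℤ := fun i => (a i : ℤ) - (b i : ℤ) with hmZ
  have hone : (∏ i, O.valuation (y i) ^ mZ i) = O.valuation 1 := by
    rw [map_one]
    have : (∏ i, O.valuation (y i) ^ mZ i) * ∏ i, O.valuation (y i) ^ ((b i : ℕ) : ℤ) =
        ∏ i, O.valuation (y i) ^ ((a i : ℕ) : ℤ) := by
      rw [← Finset.prod_mul_distrib]
      refine Finset.prod_congr rfl fun i _ => ?_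
      rw [← zpow_add₀ (hy0 i), hmZ]; ring_nf
    have hb0 : (∏ i, O.valuation (y i) ^ ((b i : ℕ) : ℤ)) ≠ 0 :=
      Finset.prod_ne_zero_iff.mpr fun i _ => zpow_ne_zero _ (hy0 i)
    calc (∏ i, O.valuation (y i) ^ mZ i)
        = ((∏ i, O.valuation (y i) ^ mZ i) * ∏ i, O.valuation (y i) ^ ((b i : ℕ) : ℤ)) *
            (∏ i, O.valuation (y i) ^ ((b i : ℕ) : ℤ))⁻¹ := by rw [mul_inv_cancel_right₀ hb0]
      _ = 1 := by rw [this, hab, mul_inv_cancel₀ hb0]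
  have hm0 : mZ = 0 := hy.2 mZ ⟨1, F₁.one_mem, hone⟩
  ext i
  have := congr_fun hm0 i
  simp only [hmZ, Pi.zero_apply, sub_eq_zero, Nat.cast_inj] at this
  exact this

end Perturbation

end Summit.ResolutionOfSingularities.ResolutionOfSingularities.Theorems.PerturbationDensity
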